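import Literature.AlgebraicGeometry.Resolution.SmoothDescentFlat
import Literature.RingTheory.Flat.FaithfullyFlatDescentFP
import HarnessLib

/-!
# Smoothness descends along faithfully flat morphisms (Stacks 05B5) — discharge

(Sibling proof file of `InseparableLocalUniformizationLemmas.lean`; the file
`InseparableLocalUniformizationLemmasProofs.lean` is taken by the proof of Temkin's Lemma 2.8.4.)
The named fact `Literature.AlgebraicGeometry.Resolution.Stacks05B5`
(`InseparableLocalUniformizationLemmas.lean`; The Stacks Project, Tag 05B5, affine case: for
ring maps `Λ → R → S` with `R → S` faithfully flat of finite presentation and `Λ → S` smooth,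
`Λ → R` is smooth) is proved: by `Stacks05B5.of_finitePresentation_descent`
(`SmoothDescentFlat.lean`: flatness of `Λ → R` by Tag 02JZ, the fibrewise criterion
Tag 00TF/01V8 and the field case Tag 05AX) it remained to descend finite presentation along the
faithfully flat map `R → S` (Tag 02KK), which is
`Literature.RingTheory.Flat.finitePresentation_of_faithfullyFlat_of_finitePresentation`
(`FaithfullyFlatDescentFP.lean`, built on the absolute Noetherian approximation, Tag 00R6 at a
prime, generic freeness, openness of the flat locus, Tags 02JO and 034Y).

## References

* [The Stacks Project, Tags 05B5, 02KK][StacksProject]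
-/

universe u

namespace Literature.AlgebraicGeometry.Resolution

/-- **Stacks 05B5 (affine form): smoothness descends along faithfully flat morphisms of finite
presentation** — discharge of the named fact `Stacks05B5`. [cite: StacksProject, Tag 05B5] -/
theorem Stacks05B5_holds : Stacks05B5.{u} :=
  Stacks05B5.of_finitePresentation_descent fun Λ R S _ _ _ _ _ _ _ hff hfp hΛS =>
    haveI := hff
    haveI := hfp
    haveI := hΛS
    Literature.RingTheory.Flat.finitePresentation_of_faithfullyFlat_of_finitePresentation Λ R S

end Literature.AlgebraicGeometry.Resolution
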